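import Mathlib

/-!
# Atkinson–Lloyd: the size of a primitive space of bounded rank (stub `stub_primitiveBound`)

Line `atkinson-lloyd-core-split` of crux `HiddenCornerLemmaR` (stmt-MatrixMultiplication-10752).
We formalise, coordinate-free (for a submodule `Y` of `E →ₗ[K] F`; no change of bases is ever
needed), the coarse form `m, n ≤ ρ(ρ+1)/2` of the second part of Theorem 1 of M. D. Atkinson,
S. Lloyd, *Primitive spaces of matrices of bounded rank*, J. Austral. Math. Soc. (A) 30 (1981)
473–482 [AL81]: genericity, Flanders' lemma (AL81 Lemma 4, `alPrim_flanders`), the rank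
inequality AL81 Lemma 5 (`alPrim_lemma5`), primitivity (iv) ⇒ row condition, AL81 Lemma 6
(`alPrim_lemma6`), and the matrix forms `alPrim_colBound_matrix` / `alPrim_rowBound_matrix`
(transposition) feeding the registered signature `stub_primitiveBound`.
-/

set_option linter.dupNamespace false

namespace Summit.MatrixMultiplication.MatrixMultiplication.Cruxes.HiddenCornerLemmaR.AtkinsonLloydCoreSplit

open Module
universe u v w

section Generic

variable {K : Type*} [Field K]
variable {S : Type*} [AddCommGroup S] [Module K S]
variable {E : Type u} [AddCommGroup E] [Module K E] [FiniteDimensional K E]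
variable {F : Type v} [AddCommGroup F] [Module K F]
variable {G : Type w} [AddCommGroup G] [Module K G]

/-- **Genericity.** If `U : S → F` is an injective linear map (with `S` finite-dimensional) then
`U + t • W` fails to be injective for only finitely many scalars `t`: for `t ≠ 0` a kernel vector
is an eigenvector of `π ∘ W` (with `π` a left inverse of `U`) for the eigenvalue `-t⁻¹`. -/
theorem alPrim_finite_setOf_not_injective_add_smul [FiniteDimensional K S] (U W : S →ₗ[K] F)
    (hU : Function.Injective U) :
    {t : K | ¬ Function.Injective (U + t • W)}.Finite := by
  obtain ⟨π, hπ⟩ := U.exists_leftInverse_of_injective (LinearMap.ker_eq_bot.2 hU)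
  set f : Module.End K S := π.comp W with hf
  have hfin : {μ : K | f.HasEigenvalue μ}.Finite := f.finite_hasEigenvalue
  refine Set.Finite.subset ((hfin.preimage (f := fun t : K => -t⁻¹)
    (fun x _ y _ h => by simpa using h)).insert 0) fun t ht => ?_
  rcases eq_or_ne t 0 with rfl | ht0
  · exact Set.mem_insert _ _
  refine Set.mem_insert_of_mem _ ?_
  simp only [Set.mem_preimage, Set.mem_setOf_eq] at ht ⊢
  have hker : ¬ (LinearMap.ker (U + t • W) = ⊥) := by rwa [LinearMap.ker_eq_bot]
  obtain ⟨c, hc, hc0⟩ := (Submodule.ne_bot_iff _).1 hker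
  rw [LinearMap.mem_ker] at hc
  refine Module.End.hasEigenvalue_of_hasEigenvector ⟨?_, hc0⟩
  rw [Module.End.mem_eigenspace_iff]
  have hπU : ∀ x, π (U x) = x := fun x => by rw [← LinearMap.comp_apply, hπ, LinearMap.id_apply]
  have h1 : c + t • f c = 0 := by
    have := congrArg π hc
    rw [LinearMap.add_apply, LinearMap.smul_apply, map_add, map_smul, hπU, map_zero] at this
    simpa [hf] using this
  calc f c = t⁻¹ • (t • f c) := by rw [smul_smul, inv_mul_cancel₀ ht0, one_smul]
    _ = (-t⁻¹) • c := by rw [eq_neg_of_add_eq_zero_right h1, smul_neg, neg_smul]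

/-- **Genericity for image dimensions.** For linear maps `A, B : E → F` and a subspace `S ≤ E`,
the image `(A + t • B)(S)` has dimension at least `dim A(S)` for all but finitely many `t`. -/
theorem alPrim_finite_setOf_finrank_map_add_smul_lt (A B : E →ₗ[K] F) (S : Submodule K E) :
    {t : K | finrank K (S.map (A + t • B)) < finrank K (S.map A)}.Finite := by
  obtain ⟨T, hT⟩ := (LinearMap.ker (A.domRestrict S)).exists_isCompl
  set j : T →ₗ[K] E := S.subtype.comp T.subtype with hj
  have hU : Function.Injective (A.comp j) := by
    rw [← LinearMap.ker_eq_bot, Submodule.eq_bot_iff]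
    intro x hx
    have hx' : (x : S) ∈ LinearMap.ker (A.domRestrict S) := by
      rw [LinearMap.mem_ker, LinearMap.domRestrict_apply]
      simpa [hj] using hx
    exact_mod_cast (Submodule.disjoint_def.1 hT.disjoint) _ hx' x.2
  refine (alPrim_finite_setOf_not_injective_add_smul (A.comp j) (B.comp j) hU).subset ?_
  intro t ht hinj
  have e1 := LinearMap.finrank_range_add_finrank_ker (A.domRestrict S)
  rw [LinearMap.range_domRestrict] at e1
  have e2 := Submodule.finrank_add_eq_of_isCompl hT
  have h2 : LinearMap.range ((A + t • B).comp j) ≤ S.map (A + t • B) := by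
    rw [LinearMap.range_comp]
    refine Submodule.map_mono ?_
    rintro _ ⟨x, rfl⟩
    simp [hj]
  have h4 : finrank K (LinearMap.range ((A + t • B).comp j)) = finrank K T :=
    LinearMap.finrank_range_of_inj (by rwa [LinearMap.add_comp, LinearMap.smul_comp])
  have h5 := Submodule.finrank_mono h2
  exact absurd ht (by simp only [Set.mem_setOf_eq, not_lt]; omega)

/-- The dimension of a subspace is at most the dimension of its image plus that of the kernel. -/
theorem alPrim_finrank_le_finrank_map_add_finrank_ker [FiniteDimensional K F] (f : F →ₗ[K] G)
    (p : Submodule K F) : finrank K p ≤ finrank K (p.map f) + finrank K (LinearMap.ker f) := by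
  have e1 := LinearMap.finrank_range_add_finrank_ker (f.domRestrict p)
  rw [LinearMap.range_domRestrict, LinearMap.ker_domRestrict] at e1
  have e2 : finrank K ((LinearMap.ker f).comap p.subtype) ≤ finrank K (LinearMap.ker f) := by
    rw [← Submodule.finrank_map_subtype_eq p, Submodule.map_comap_subtype]
    exact Submodule.finrank_mono inf_le_right
  omega

/-- For one linear map `C` of block shape `[[W, U], [V, 0]]` (i.e. `P ∘ C` kills `E₂`, where
`ker P` plays the role of the top rows): `rank U + rank V ≤ rank C`. -/
theorem alPrim_finrank_map_add_finrank_range_comp_le [FiniteDimensional K F] (C : E →ₗ[K] F)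
    (P : F →ₗ[K] G) (E₂ : Submodule K E) (h : ∀ v ∈ E₂, P (C v) = 0) :
    finrank K (E₂.map C) + finrank K (LinearMap.range (P.comp C)) ≤
      finrank K (LinearMap.range C) := by
  have hrn := LinearMap.finrank_range_add_finrank_ker (P.domRestrict (LinearMap.range C))
  rw [LinearMap.range_domRestrict, LinearMap.ker_domRestrict] at hrn
  have hle : E₂.map C ≤ LinearMap.range C := LinearMap.map_le_range
  have hle2 : (E₂.map C).comap (LinearMap.range C).subtype ≤
      (LinearMap.ker P).comap (LinearMap.range C).subtype := by
    refine Submodule.comap_mono ?_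
    rintro _ ⟨v, hv, rfl⟩
    exact h v hv
  have h2 := Submodule.finrank_mono hle2
  rw [LinearMap.range_comp, ← (Submodule.comapSubtypeEquivOfLe hle).finrank_eq]
  omega

variable [Infinite K]

/-- **Flanders' lemma** (AL81 Lemma 4, coordinate-free): if `A₀ ∈ Y` attains the upper rank `ρ`
of `Y`, every `M ∈ Y` maps `ker A₀` into `range A₀` (in adapted bases `Y` consists of matrices
`[[T, U], [V, 0]]`, `T` of size `ρ × ρ`); otherwise a generic `A₀ + t • M` has rank `ρ + 1`. -/
theorem alPrim_flanders (Y : Submodule K (E →ₗ[K] F)) (ρ : ℕ)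
    (h1 : ∀ M ∈ Y, finrank K (LinearMap.range M) ≤ ρ)
    (A₀ : E →ₗ[K] F) (hA₀ : A₀ ∈ Y) (hρ : finrank K (LinearMap.range A₀) = ρ) :
    ∀ M ∈ Y, (LinearMap.ker A₀).map M ≤ LinearMap.range A₀ := by
  rintro M hM _ ⟨v, hv, rfl⟩
  by_contra hMv
  have hv0 : A₀ v = 0 := hv
  obtain ⟨T, hT⟩ := (LinearMap.ker A₀).exists_isCompl
  have hTdim : finrank K T = ρ := by
    have := Submodule.finrank_add_eq_of_isCompl hT; have := A₀.finrank_range_add_finrank_ker; omega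
  let U : (T × K) →ₗ[K] F := (A₀.comp T.subtype).coprod (LinearMap.toSpanSingleton K F (M v))
  let W : (T × K) →ₗ[K] F := (M.comp T.subtype).coprod 0
  have hUapp : ∀ (s : T) (c : K), U (s, c) = A₀ s + c • M v := fun s c => by
    simp [U, LinearMap.coprod_apply]
  have hWapp : ∀ (s : T) (c : K), W (s, c) = M s := fun s c => by
    simp [W, LinearMap.coprod_apply]
  have hU : Function.Injective U := by
    rw [← LinearMap.ker_eq_bot, Submodule.eq_bot_iff]
    rintro ⟨s, c⟩ hx
    rw [LinearMap.mem_ker, hUapp] at hx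
    have hc : c = 0 := by
      by_contra hc
      refine hMv ⟨-(c⁻¹ • (s : E)), ?_⟩
      have : c • M v = -A₀ s := eq_neg_of_add_eq_zero_right hx
      calc A₀ (-(c⁻¹ • (s : E))) = c⁻¹ • (-A₀ s) := by rw [map_neg, map_smul, smul_neg]
        _ = M v := by rw [← this, smul_smul, inv_mul_cancel₀ hc, one_smul]
    subst hc
    rw [zero_smul, add_zero] at hx
    have : s = 0 := by
      exact_mod_cast (Submodule.disjoint_def.1 hT.disjoint) _ (show (s : E) ∈ A₀.ker from hx) s.2
    simp [this]
  obtain ⟨t, ht⟩ := Infinite.exists_notMem_finset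
    ((alPrim_finite_setOf_not_injective_add_smul U W hU).insert 0).toFinset
  rw [Set.Finite.mem_toFinset, Set.mem_insert_iff, not_or] at ht
  obtain ⟨ht0, ht⟩ := ht
  simp only [Set.mem_setOf_eq, not_not] at ht
  have hCY : A₀ + t • M ∈ Y := Y.add_mem hA₀ (Y.smul_mem t hM)
  have hCv : (A₀ + t • M) v = t • M v := by
    rw [LinearMap.add_apply, LinearMap.smul_apply, hv0, zero_add]
  have hle : LinearMap.range (U + t • W) ≤ LinearMap.range (A₀ + t • M) := by
    rintro _ ⟨⟨s, c⟩, rfl⟩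
    refine ⟨(s : E) + (c * t⁻¹) • v, ?_⟩
    rw [map_add, map_smul, hCv, smul_smul, mul_assoc, inv_mul_cancel₀ ht0, mul_one]
    simp only [LinearMap.add_apply, LinearMap.smul_apply]
    rw [hUapp, hWapp]
    abel
  have h3 := Submodule.finrank_mono hle
  rw [LinearMap.finrank_range_of_inj ht, Module.finrank_prod, hTdim, Module.finrank_self] at h3
  exact absurd (h1 _ hCY) (by omega)

/-- **AL81 Lemma 5** (rank inequality for a partitioned space, coordinate-free): if every member of
`Y` has block shape `[[W, U], [V, 0]]` — `E₂` the right-hand columns, `ker P ⊇` the image of `E₂`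
— then for `A, B ∈ Y` some `C ∈ Y` (a generic `A + t • B`) has `rank C ≥ rank U_A + rank V_B`. -/
theorem alPrim_lemma5 [FiniteDimensional K F] [FiniteDimensional K G]
    (Y : Submodule K (E →ₗ[K] F)) (E₂ : Submodule K E) (P : F →ₗ[K] G)
    (hP : ∀ M ∈ Y, ∀ v ∈ E₂, P (M v) = 0) (A B : E →ₗ[K] F) (hA : A ∈ Y) (hB : B ∈ Y) :
    ∃ C ∈ Y, finrank K (E₂.map A) + finrank K (LinearMap.range (P.comp B)) ≤
      finrank K (LinearMap.range C) := by
  have hfin1 := alPrim_finite_setOf_finrank_map_add_smul_lt A B E₂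
  have hfin3 := (alPrim_finite_setOf_finrank_map_add_smul_lt (P.comp B) (P.comp A) ⊤).preimage
    (f := fun t : K => t⁻¹) (fun x _ y _ h => inv_injective h)
  obtain ⟨t, ht⟩ := Infinite.exists_notMem_finset ((hfin1.union hfin3).insert 0).toFinset
  rw [Set.Finite.mem_toFinset, Set.mem_insert_iff, not_or, Set.mem_union, not_or] at ht
  obtain ⟨ht0, ht1, ht3⟩ := ht
  simp only [Set.mem_setOf_eq, not_lt, Set.mem_preimage] at ht1 ht3
  have hCY : A + t • B ∈ Y := Y.add_mem hA (Y.smul_mem t hB)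
  refine ⟨A + t • B, hCY, le_trans (add_le_add ht1 ?_)
    (alPrim_finrank_map_add_finrank_range_comp_le (A + t • B) P E₂ (hP _ hCY))⟩
  have : P.comp (A + t • B) = t • (P.comp B + t⁻¹ • P.comp A) := by
    rw [smul_add, smul_smul, mul_inv_cancel₀ ht0, one_smul, LinearMap.comp_add,
      LinearMap.comp_smul, add_comm]
  rw [this, LinearMap.range_smul _ _ ht0, LinearMap.range_eq_map, LinearMap.range_eq_map]
  exact ht3

/-- The **row condition** of AL81 (p. 476), coordinate-free: whenever `Y` has block shape
`[[A, B], [C, 0]]` with a non-empty set of top rows, no block `B` has full row rank, i.e. no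
`M ∈ Y` maps a subspace `E₂` ONTO the joint image `Σ_{M'} M'(E₂)` unless that is zero.
**Primitivity (iv) implies the row condition** (AL81 pp. 478–479): if modulo every line of `F`
some member of `Y` keeps the upper rank `ρ`, then `Y` has the row condition (by Lemma 5 a
full-row-rank top-right block of height `k` forces rank `≤ ρ - 1` modulo its first row). -/
theorem alPrim_rowCond_of_primitive [FiniteDimensional K F] (Y : Submodule K (E →ₗ[K] F)) (ρ : ℕ)
    (h1 : ∀ M ∈ Y, finrank K (LinearMap.range M) ≤ ρ)
    (hiv : ∀ ψ : F, ψ ≠ 0 → ∃ M ∈ Y, ρ + 1 ≤ finrank K ↥(LinearMap.range M ⊔ K ∙ ψ)) :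
    ∀ (E₂ : Submodule K E), ∀ M ∈ Y, (∀ M' ∈ Y, E₂.map M' ≤ E₂.map M) → E₂.map M = ⊥ := by
  intro E₂ M hM hmax
  by_contra hne
  obtain ⟨ψ, hψF, hψ0⟩ := (Submodule.ne_bot_iff _).1 hne
  obtain ⟨M', hM', hrk⟩ := hiv ψ hψ0
  have hP : ∀ M'' ∈ Y, ∀ v ∈ E₂, (E₂.map M).mkQ (M'' v) = 0 := fun M'' hM'' v hv =>
    (Submodule.Quotient.mk_eq_zero (E₂.map M)).2 (hmax M'' hM'' ⟨v, hv, rfl⟩)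
  obtain ⟨C, hC, hle⟩ := alPrim_lemma5 Y E₂ (E₂.map M).mkQ hP M M' hM hM'
  have e1 : (LinearMap.range M' ⊔ K ∙ ψ).map (E₂.map M).mkQ =
      LinearMap.range ((E₂.map M).mkQ.comp M') := by
    have : (K ∙ ψ).map (E₂.map M).mkQ = ⊥ := by
      rw [← LinearMap.le_ker_iff_map, Submodule.ker_mkQ, Submodule.span_singleton_le_iff_mem]
      exact hψF
    rw [LinearMap.range_comp, Submodule.map_sup, this, sup_bot_eq]
  have e2 :=
    alPrim_finrank_le_finrank_map_add_finrank_ker (E₂.map M).mkQ (LinearMap.range M' ⊔ K ∙ ψ)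
  rw [e1, Submodule.ker_mkQ] at e2
  have := h1 C hC
  omega

/-- **AL81 Lemma 6** (first part, coordinate-free): a space `Y` of maps of rank `≤ r` with the row
condition kills a common subspace `N` of codimension `≤ r(r+1)/2` (`Y` lives in `r(r+1)/2`
columns); induction on `r`: restricted to `ker A₀` (`A₀` of top rank, Flanders) the space has
rank `≤ r - 1` and inherits the row condition. -/
theorem alPrim_lemma6 (r : ℕ) :
    ∀ {E : Type u} {F : Type v} [AddCommGroup E] [Module K E] [FiniteDimensional K E]
      [AddCommGroup F] [Module K F] [FiniteDimensional K F] (Y : Submodule K (E →ₗ[K] F)),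
      (∀ M ∈ Y, finrank K (LinearMap.range M) ≤ r) →
      (∀ (E₂ : Submodule K E), ∀ M ∈ Y, (∀ M' ∈ Y, E₂.map M' ≤ E₂.map M) → E₂.map M = ⊥) →
      ∃ N : Submodule K E, (∀ M ∈ Y, ∀ v ∈ N, M v = 0) ∧
        2 * finrank K E ≤ r * (r + 1) + 2 * finrank K N := by
  induction r with
  | zero =>
    intro E F _ _ _ _ _ _ Y h1 _
    refine ⟨⊤, fun M hM v _ => ?_, by simp [finrank_top]⟩
    have h0 : LinearMap.range M = ⊥ := Submodule.finrank_eq_zero.1 (Nat.le_zero.1 (h1 M hM))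
    rw [LinearMap.range_eq_bot.1 h0, LinearMap.zero_apply]
  | succ r ih =>
    intro E F _ _ _ _ _ _ Y h1 hrc
    by_cases hall : ∀ M ∈ Y, finrank K (LinearMap.range M) ≤ r
    · obtain ⟨N, hN, hle⟩ := ih Y hall hrc
      exact ⟨N, hN, by nlinarith⟩
    push Not at hall
    obtain ⟨A₀, hA₀, hgt⟩ := hall
    have hρ : finrank K (LinearMap.range A₀) = r + 1 := le_antisymm (h1 A₀ hA₀) hgt
    have hfl := alPrim_flanders Y (r + 1) h1 A₀ hA₀ hρ
    set E₂ := LinearMap.ker A₀ with hE₂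
    set Y' : Submodule K (E₂ →ₗ[K] F) := Y.map (LinearMap.lcomp K F E₂.subtype) with hY'
    have hmem : ∀ N ∈ Y', ∃ M ∈ Y, N = M.comp E₂.subtype := fun N hN => by
      obtain ⟨M, hM, rfl⟩ := Submodule.mem_map.1 hN
      exact ⟨M, hM, rfl⟩
    have hmem' : ∀ M ∈ Y, M.comp E₂.subtype ∈ Y' := fun M hM => Submodule.mem_map_of_mem hM
    have h1' : ∀ N ∈ Y', finrank K (LinearMap.range N) ≤ r := by
      intro N hN
      obtain ⟨M, hM, rfl⟩ := hmem N hN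
      rw [LinearMap.range_comp, Submodule.range_subtype]
      by_contra hlt
      have heq : E₂.map M = LinearMap.range A₀ :=
        Submodule.eq_of_le_of_finrank_le (hfl M hM) (by omega)
      have hbot := hrc E₂ M hM (fun M' hM' => heq ▸ hfl M' hM')
      rw [hbot] at heq
      rw [← heq, finrank_bot] at hρ
      omega
    have hrc' : ∀ (E₂' : Submodule K E₂), ∀ N ∈ Y', (∀ N' ∈ Y', E₂'.map N' ≤ E₂'.map N) →
        E₂'.map N = ⊥ := by
      intro E₂' N hN hmax
      obtain ⟨M, hM, rfl⟩ := hmem N hN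
      have key := hrc (E₂'.map E₂.subtype) M hM fun M' hM' => by
        simpa only [Submodule.map_comp] using hmax (M'.comp E₂.subtype) (hmem' M' hM')
      rwa [← Submodule.map_comp] at key
    obtain ⟨N', hN', hle'⟩ := ih Y' h1' hrc'
    refine ⟨N'.map E₂.subtype, fun M hM v hv => ?_, ?_⟩
    · obtain ⟨v', hv', rfl⟩ := Submodule.mem_map.1 hv
      exact hN' (M.comp E₂.subtype) (hmem' M hM) v' hv'
    · rw [Submodule.finrank_map_subtype_eq]
      have e := A₀.finrank_range_add_finrank_ker
      rw [hρ] at e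
      nlinarith [hle']

/-- **Column bound for primitive spaces** (coarse AL81 Theorem 1, second part, coordinate-free):
if `Y ≤ Hom(E, F)` has upper rank `≤ ρ`, no common kernel vector (primitivity (ii)) and modulo
every line of `F` some member keeps rank `ρ` (primitivity (iv)), then `dim E ≤ ρ(ρ+1)/2`:
row condition by (iv), Lemma 6, and the common kernel is zero by (ii). -/
theorem alPrim_colBound [FiniteDimensional K F] (Y : Submodule K (E →ₗ[K] F)) (ρ : ℕ)
    (h1 : ∀ M ∈ Y, finrank K (LinearMap.range M) ≤ ρ)
    (hii : ∀ v : E, (∀ M ∈ Y, M v = 0) → v = 0)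
    (hiv : ∀ ψ : F, ψ ≠ 0 → ∃ M ∈ Y, ρ + 1 ≤ finrank K ↥(LinearMap.range M ⊔ K ∙ ψ)) :
    2 * finrank K E ≤ ρ * (ρ + 1) := by
  obtain ⟨N, hN, hle⟩ := alPrim_lemma6 ρ Y h1 (alPrim_rowCond_of_primitive Y ρ h1 hiv)
  have hbot : N = ⊥ := (Submodule.eq_bot_iff N).2 fun v hv => hii v fun M hM => hN M hM v hv
  rw [hbot, finrank_bot] at hle
  omega

end Generic

/-- **Column bound, matrix form**: a linear space `Y` of `ι × κ` complex matrices of rank `≤ ρ`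
with no common (right) kernel vector and primitivity (iv) — modulo every line `ℂ ψ` of `ℂ^ι` some
member keeps rank `ρ`, witnessed by `C : ρ × ι`, `C ψ = 0`, `rank (C A) = ρ` — has
`2 #κ ≤ ρ(ρ+1)`. -/
theorem alPrim_colBound_matrix {ι κ : Type} [Fintype ι] [Fintype κ] [DecidableEq ι] [DecidableEq κ]
    (Y : Submodule ℂ (Matrix ι κ ℂ)) (ρ : ℕ) (h1 : ∀ A ∈ Y, A.rank ≤ ρ)
    (hii : ∀ v : κ → ℂ, (∀ A ∈ Y, Matrix.mulVec A v = 0) → v = 0)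
    (hiv : ∀ ψ : ι → ℂ, ψ ≠ 0 → ∃ A ∈ Y, ∃ C : Matrix (Fin ρ) ι ℂ,
      Matrix.mulVec C ψ = 0 ∧ (C * A).rank = ρ) :
    2 * Fintype.card κ ≤ ρ * (ρ + 1) := by
  let Y' : Submodule ℂ ((κ → ℂ) →ₗ[ℂ] (ι → ℂ)) :=
    Y.map (Matrix.toLin' : Matrix ι κ ℂ ≃ₗ[ℂ] ((κ → ℂ) →ₗ[ℂ] (ι → ℂ))).toLinearMap
  have hmem : ∀ M ∈ Y', ∃ A ∈ Y, M = Matrix.toLin' A := fun M hM => by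
    obtain ⟨A, hA, rfl⟩ := Submodule.mem_map.1 hM
    exact ⟨A, hA, rfl⟩
  have hmem' : ∀ A ∈ Y, Matrix.toLin' A ∈ Y' := fun A hA => Submodule.mem_map_of_mem hA
  have hrank : ∀ {m : Type} [Fintype m] (A : Matrix m κ ℂ),
      finrank ℂ (LinearMap.range (Matrix.toLin' A)) = A.rank := fun A => by
    rw [Matrix.toLin'_apply']; rfl
  have key := alPrim_colBound Y' ρ ?_ ?_ ?_
  · simpa [Module.finrank_fintype_fun_eq_card] using key
  · intro M hM
    obtain ⟨A, hA, rfl⟩ := hmem M hM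
    exact (hrank A).symm ▸ h1 A hA
  · refine fun v hv => hii v fun A hA => ?_
    rw [← Matrix.toLin'_apply]
    exact hv _ (hmem' A hA)
  · intro ψ hψ
    obtain ⟨A, hA, C, hC, hrk⟩ := hiv ψ hψ
    refine ⟨Matrix.toLin' A, hmem' A hA, ?_⟩
    set P₀ := Matrix.toLin' C with hP₀
    set R' := LinearMap.range (Matrix.toLin' A) ⊔ ℂ ∙ ψ with hR'
    have hrn := LinearMap.finrank_range_add_finrank_ker (P₀.domRestrict R')
    rw [LinearMap.range_domRestrict] at hrn
    have e1 : ρ ≤ finrank ℂ (R'.map P₀) := by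
      have e : finrank ℂ (LinearMap.range (P₀.comp (Matrix.toLin' A))) = (C * A).rank := by
        rw [hP₀, ← Matrix.toLin'_mul]; exact hrank (C * A)
      have hle : LinearMap.range (P₀.comp (Matrix.toLin' A)) ≤ R'.map P₀ := by
        rw [LinearMap.range_comp]; exact Submodule.map_mono le_sup_left
      have := Submodule.finrank_mono hle
      omega
    have e2 : 1 ≤ finrank ℂ (LinearMap.ker (P₀.domRestrict R')) := by
      rw [Nat.one_le_iff_ne_zero]
      intro h0
      have hψR : ψ ∈ R' := Submodule.mem_sup_right (Submodule.mem_span_singleton_self ψ)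
      have hmk : (⟨ψ, hψR⟩ : R') ∈ LinearMap.ker (P₀.domRestrict R') := by
        rw [LinearMap.mem_ker, LinearMap.domRestrict_apply, hP₀, Matrix.toLin'_apply]
        exact hC
      rw [Submodule.finrank_eq_zero.1 h0, Submodule.mem_bot] at hmk
      exact hψ (congrArg Subtype.val hmk)
    omega

/-- **Row bound, matrix form** (the transpose of `alPrim_colBound_matrix`): rank `≤ ρ`, no common
left kernel vector (primitivity (i)) and primitivity (iii) — on every hyperplane `ker φ` of `ℂ^κ`
some member keeps rank `ρ` — give `2 · #ι ≤ ρ(ρ+1)`. -/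
theorem alPrim_rowBound_matrix {ι κ : Type} [Fintype ι] [Fintype κ] [DecidableEq ι] [DecidableEq κ]
    (Y : Submodule ℂ (Matrix ι κ ℂ)) (ρ : ℕ) (h1 : ∀ A ∈ Y, A.rank ≤ ρ)
    (hi : ∀ w : ι → ℂ, (∀ A ∈ Y, Matrix.vecMul w A = 0) → w = 0)
    (hiii : ∀ φ : κ → ℂ, φ ≠ 0 → ∃ A ∈ Y, ∃ B : Matrix κ (Fin ρ) ℂ,
      Matrix.vecMul φ B = 0 ∧ (A * B).rank = ρ) :
    2 * Fintype.card ι ≤ ρ * (ρ + 1) := by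
  let Yt : Submodule ℂ (Matrix κ ι ℂ) := Y.map (Matrix.transposeLinearEquiv ι κ ℂ ℂ).toLinearMap
  have hmem : ∀ A ∈ Yt, ∃ B ∈ Y, A = B.transpose := fun A hA => by
    obtain ⟨B, hB, rfl⟩ := Submodule.mem_map.1 hA
    exact ⟨B, hB, rfl⟩
  have hmem' : ∀ B ∈ Y, B.transpose ∈ Yt := fun B hB => Submodule.mem_map_of_mem hB
  refine alPrim_colBound_matrix Yt ρ ?_ ?_ ?_
  · intro A hA
    obtain ⟨B, hB, rfl⟩ := hmem A hA
    exact (Matrix.rank_transpose B).symm ▸ h1 B hB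
  · refine fun v hv => hi v fun A hA => ?_
    rw [← Matrix.mulVec_transpose]
    exact hv _ (hmem' A hA)
  · intro φ hφ
    obtain ⟨A, hA, B, hB, hrk⟩ := hiii φ hφ
    refine ⟨A.transpose, hmem' A hA, B.transpose, by rwa [Matrix.mulVec_transpose], ?_⟩
    rw [← Matrix.transpose_mul, Matrix.rank_transpose]
    exact hrk

/-- **stub 1b — `stub_primitiveBound`: Atkinson–Lloyd's size bound for primitive spaces**
(M. D. Atkinson, S. Lloyd, *Primitive spaces of matrices of bounded rank*, J. Austral. Math. Soc.
(A) 30 (1981), Theorem 1, second part, coarse form "`m, n ≤ r(r+1)/2`"): a linear space `Y` of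
`ι × κ` complex matrices of upper rank `ρ` satisfying the four primitivity conditions — (i) no
common left kernel vector, (ii) no common right kernel vector, (iii) on every hyperplane of `ℂ^κ`
some member keeps rank `ρ`, (iv) modulo every line of `ℂ^ι` some member keeps rank `ρ` — has
`2·#ι ≤ ρ(ρ+1)` and `2·#κ ≤ ρ(ρ+1)`.  Proof: (iv) + Lemma 5 ⇒ row condition; Lemma 6 (Flanders'
lemma, induction on `ρ`) ⇒ the common kernel has codimension `≤ ρ(ρ+1)/2`; (ii) ⇒ it is zero;
rows by transposition (the exact-rank hypothesis is not needed). -/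
theorem stub_primitiveBound :
    ∀ (ι κ : Type) [Fintype ι] [Fintype κ] [DecidableEq ι] [DecidableEq κ]
      (Y : Submodule ℂ (Matrix ι κ ℂ)) (ρ : ℕ),
      (∀ A ∈ Y, A.rank ≤ ρ) → (∃ A ∈ Y, A.rank = ρ) →
      (∀ w : ι → ℂ, (∀ A ∈ Y, Matrix.vecMul w A = 0) → w = 0) →
      (∀ v : κ → ℂ, (∀ A ∈ Y, Matrix.mulVec A v = 0) → v = 0) →
      (∀ φ : κ → ℂ, φ ≠ 0 → ∃ A ∈ Y, ∃ B : Matrix κ (Fin ρ) ℂ, Matrix.vecMul φ B = 0 ∧ (A * B).rank = ρ) →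
      (∀ ψ : ι → ℂ, ψ ≠ 0 → ∃ A ∈ Y, ∃ C : Matrix (Fin ρ) ι ℂ, Matrix.mulVec C ψ = 0 ∧ (C * A).rank = ρ) →
      2 * Fintype.card ι ≤ ρ * (ρ + 1) ∧ 2 * Fintype.card κ ≤ ρ * (ρ + 1) := by
  intro ι κ _ _ _ _ Y ρ h1 _ hi hii hiii hiv
  exact ⟨alPrim_rowBound_matrix Y ρ h1 hi hiii, alPrim_colBound_matrix Y ρ h1 hii hiv⟩

end Summit.MatrixMultiplication.MatrixMultiplication.Cruxes.HiddenCornerLemmaR.AtkinsonLloydCoreSplit
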